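import Summits.BirchSwinnertonDyer.BirchSwinnertonDyer.Theorems.ResidualThetaTransportAtTwoLambdaLowerBoundOExact
import Summits.BirchSwinnertonDyer.BirchSwinnertonDyer.Theorems.ResidualThetaTransportAtTwoLambdaLowerBoundOWeierstrass
import Mathlib.Order.Disjoint
import HarnessLib

/-!
# Sketch (stub-ideation k2 g23) — the `hPT` PORT of child B⁻ ANATOMISED at `p = 2`:
# typed λ-glue of the anatomy + the two elementary dictionary lines that have no odd-`p` counterpart

Crux `ResidualThetaCountLowerPureAtTwo` (stmt-BirchSwinnertonDyer-26074), STUB `stub_cmLambdaLower`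
(= RSL_g, stmt-BirchSwinnertonDyer-22608, text verbatim), route `ResidualThetaTransportAtTwo`.
HONEST FRAMING: THEOREMS ONLY over abstract modules (no definition of record, no named fact, no instance,
no notation, no `sorry`); nothing here is about curves or Galois cohomology; BSD is NOT proved by any of
this; 26074 / 22608 / 24105 stay OPEN / HOLD. The cohomological identifications that would instantiate the
hypotheses below (Kato's `𝐇²` with `j_*`, Poitou–Tate at the finite layers `ℚ_n`, excision) are PRINT and
are NOT typed here — see the card `Ideas/stub_cmLambdaLower-k2.md` (g23) for the dictionary with locators.

## What is typed

§1 `portAnatomy` glue (λ-currency `dim_K (K ⊗_R ·)`, `K = Frac R`):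
  the port's output shape is: a surjection `e : H2K ↠ K∞` whose kernel is killed by a non-zero scalar
  (excision kernel at the primes of `M`, finite by CM weights), an injection `i : X0 ↪ K∞` with cokernel
  `L` (the `{2, ∞}`-local `H⁰`-duals, Poitou–Tate) and `L` killed by a non-zero scalar (on the habitat
  `L = 0`). Conclusion: `λ(H2K) = λ(X0)` — so child B⁻'s consumed direction `λ(𝐇²) ≤ λ(Sel₀^∨)` holds
  with EQUALITY, and finiteness transfers in both directions.
§2 `cancel` — the level-`n` CANCELLATION of the `S₀`-local terms (pure linear algebra): for a surjection
  `loc : H2U ↠ P₀ × P₂` (Poitou–Tate with vanishing global `H⁰`-dual), the submodule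
  `ker (fst ∘ loc)` (= image of `H²(X_n, j_*T)` by excision) surjects onto `P₂` with kernel `ker loc`
  (= `X_str`): the `S₀`-terms `P₀` never enter.
§3 `induced` — the archimedean dictionary line at `p = 2`: an involution `c` on `M` with a submodule `N`
  such that `N ⊕ c N = M` has fixed points = norms and `ker (1 + c) = im (1 - c)`, i.e. both Tate groups
  `Ĥ⁰(C₂, M)`, `Ĥ⁻¹(C₂, M)` vanish (applied in the card to `W[2]` with `Δ_W < 0`, where `c` is a transposition).
§4 `natCard_seqLimit_le` — an inverse limit of finite sets of cardinality `≤ B` has cardinality `≤ B` (the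
  finiteness of the excision kernel `ker_∞` in the (KER) step).
-/

set_option autoImplicit false
-- the Cruxes namespace of this sub repeats the summit name by design (D-0017 nested layout)
set_option linter.dupNamespace false

noncomputable section

open scoped TensorProduct

namespace Summit.BirchSwinnertonDyer.BirchSwinnertonDyer.Cruxes.ResidualThetaCountLowerPureAtTwo.SideaK2G23

open Summit.BirchSwinnertonDyer.BirchSwinnertonDyer.Theorems

universe u v w

/-! ## §1 The λ-glue of the port anatomy -/

section PortAnatomy

variable {R : Type u} [CommRing R] (K : Type v) [Field K] [Algebra R K] [IsFractionRing R K]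

/-- A non-zero scalar of the domain `R` is a unit of `K = Frac R`. [folklore] -/
theorem isUnit_algebraMap_of_ne_zero [IsDomain R] {c : R} (hc : c ≠ 0) : IsUnit (algebraMap R K c) :=
  IsLocalization.map_units K ⟨c, mem_nonZeroDivisors_of_ne_zero hc⟩

/-- `K ⊗_R L = 0` when a non-zero scalar kills `L`. [folklore] -/
theorem subsingleton_baseChange_of_smul_eq_zero [IsDomain R] {L : Type w} [AddCommGroup L] [Module R L]
    {c : R} (hc : c ≠ 0) (hL : ∀ x : L, c • x = 0) : Subsingleton (K ⊗[R] L) := by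
  have hcK := isUnit_algebraMap_of_ne_zero K hc
  refine ⟨fun z w ↦ ?_⟩
  suffices h : ∀ z : K ⊗[R] L, z = 0 by rw [h z, h w]
  intro z
  induction z using TensorProduct.induction_on with
  | zero => rfl
  | tmul q x =>
      have hq : q = c • (q * hcK.unit⁻¹.1) := by
        rw [Algebra.smul_def, mul_left_comm, IsUnit.mul_val_inv, mul_one]
      rw [hq, TensorProduct.smul_tmul, hL x, TensorProduct.tmul_zero]
  | add x y hx hy => rw [hx, hy, add_zero]

/-- **Injection with scalar-killed cokernel preserves `λ`**: `0 → X0 → K∞ → L → 0` exact with `c • L = 0`,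
`c ≠ 0`, gives `dim_K(K ⊗ K∞) = dim_K(K ⊗ X0)`. [folklore; Washington1997 §13.2] -/
theorem finrank_baseChange_eq_of_injective_of_smul_coker [IsDomain R] {X0 Kinf L : Type w}
    [AddCommGroup X0] [Module R X0] [AddCommGroup Kinf] [Module R Kinf] [AddCommGroup L] [Module R L]
    (i : X0 →ₗ[R] Kinf) (q : Kinf →ₗ[R] L) (hi : Function.Injective i) (hiq : Function.Exact i q)
    (hq : Function.Surjective q) {c : R} (hc : c ≠ 0) (hL : ∀ x : L, c • x = 0)
    [FiniteDimensional K (K ⊗[R] Kinf)] :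
    Module.finrank K (K ⊗[R] Kinf) = Module.finrank K (K ⊗[R] X0) := by
  haveI := subsingleton_baseChange_of_smul_eq_zero K hc hL
  have h := LambdaLowerBoundO.finrank_baseChange_eq_of_exact_three K i q hi hiq hq
  rw [Module.finrank_zero_of_subsingleton (M := K ⊗[R] L), add_zero] at h
  exact h

omit [IsFractionRing R K] in
/-- Finiteness transfer along a surjection (right exactness of `K ⊗_R ·`). [folklore] -/
theorem finite_baseChange_of_surjective {M N : Type w} [AddCommGroup M] [Module R M] [AddCommGroup N]
    [Module R N] (e : M →ₗ[R] N) (he : Function.Surjective e) [Module.Finite K (K ⊗[R] M)] :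
    Module.Finite K (K ⊗[R] N) := by
  refine Module.Finite.of_surjective (e.baseChange K) ?_
  rw [LinearMap.baseChange_eq_ltensor]
  exact LinearMap.lTensor_surjective K he

/-- Finiteness transfer along an injection (flatness of `K = Frac R`). [folklore] -/
theorem finite_baseChange_of_injective {M N : Type w} [AddCommGroup M] [Module R M] [AddCommGroup N]
    [Module R N] (i : M →ₗ[R] N) (hi : Function.Injective i) [Module.Finite K (K ⊗[R] N)] :
    Module.Finite K (K ⊗[R] M) := by
  haveI : Module.Flat R K := IsLocalization.flat K (nonZeroDivisors R)
  refine Module.Finite.of_injective (i.baseChange K) ?_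
  rw [LinearMap.baseChange_eq_ltensor]
  exact Module.Flat.lTensor_preserves_injective_linearMap i hi

/-- **THE PORT ANATOMY IN λ-CURRENCY (`hPT` with equality).** Abstract `R`-modules standing for
`H2K = 𝐇²_Γ(T_ρ)` (Kato, `j_*`), `K∞ = lim_n ker(H²(G_S(ℚ_n),T_ρ) → ⊕_{v∈S₀} H²(ℚ_{n,v},T_ρ))`,
`X0 = Sel₀(ℚ_∞, A_ρ)^∨` (strict at `2`, unramified = strict at `S₀`), `L = lim_n (H⁰(ℚ_{n,2},A_ρ)^∨ ⊕ ⊕_{v∣∞} Ĥ⁰(ℚ_{n,v},A_ρ)^∨)`.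
Hypotheses = the port's output: `e : H2K ↠ K∞` with kernel killed by `c₁ ≠ 0` (excision + CM weights + the
`S₀`-cancellation), `0 → X0 → K∞ → L → 0` (Poitou–Tate, global `H⁰(A_ρ') = 0`), `c₂ • L = 0` (habitat:
in fact `L = 0`). Conclusion: `λ(H2K) = λ(X0)`. [folklore algebra; the instantiation is PRINT∘PORT, see card] -/
theorem finrank_baseChange_H2_eq_X0_of_portAnatomy [IsDomain R] {H2K Kinf X0 L : Type w}
    [AddCommGroup H2K] [Module R H2K] [AddCommGroup Kinf] [Module R Kinf]
    [AddCommGroup X0] [Module R X0] [AddCommGroup L] [Module R L]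
    (e : H2K →ₗ[R] Kinf) (he : Function.Surjective e) {c₁ : R} (hc₁ : c₁ ≠ 0)
    (hker : ∀ x ∈ LinearMap.ker e, c₁ • x = 0)
    (i : X0 →ₗ[R] Kinf) (q : Kinf →ₗ[R] L) (hi : Function.Injective i) (hiq : Function.Exact i q)
    (hq : Function.Surjective q) {c₂ : R} (hc₂ : c₂ ≠ 0) (hL : ∀ x : L, c₂ • x = 0)
    [Module.Finite K (K ⊗[R] H2K)] :
    Module.finrank K (K ⊗[R] H2K) = Module.finrank K (K ⊗[R] X0) := by
  haveI : Module.Finite K (K ⊗[R] Kinf) := finite_baseChange_of_surjective K e he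
  rw [LambdaLowerBoundO.finrank_baseChange_eq_of_surjective_of_smul_ker_eq_zero K e he c₁
    (isUnit_algebraMap_of_ne_zero K hc₁) hker]
  exact finrank_baseChange_eq_of_injective_of_smul_coker K i q hi hiq hq hc₂ hL

/-- **`hPT` as consumed by child B⁻ / k2-g16's adapter** (`λ(𝐇²) ≤ λ(Sel₀^∨)`), from the anatomy. -/
theorem hPT_of_portAnatomy [IsDomain R] {H2K Kinf X0 L : Type w}
    [AddCommGroup H2K] [Module R H2K] [AddCommGroup Kinf] [Module R Kinf]
    [AddCommGroup X0] [Module R X0] [AddCommGroup L] [Module R L]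
    (e : H2K →ₗ[R] Kinf) (he : Function.Surjective e) {c₁ : R} (hc₁ : c₁ ≠ 0)
    (hker : ∀ x ∈ LinearMap.ker e, c₁ • x = 0)
    (i : X0 →ₗ[R] Kinf) (q : Kinf →ₗ[R] L) (hi : Function.Injective i) (hiq : Function.Exact i q)
    (hq : Function.Surjective q) {c₂ : R} (hc₂ : c₂ ≠ 0) (hL : ∀ x : L, c₂ • x = 0)
    [Module.Finite K (K ⊗[R] H2K)] :
    Module.finrank K (K ⊗[R] H2K) ≤ Module.finrank K (K ⊗[R] X0) :=
  (finrank_baseChange_H2_eq_X0_of_portAnatomy K e he hc₁ hker i q hi hiq hq hc₂ hL).le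

/-- … and the finiteness of `K ⊗ X0` (needed to read `lamO S (Sel₀^∨)` as a rank), from that of `K ⊗ 𝐇²`. -/
theorem finite_baseChange_X0_of_portAnatomy {H2K Kinf X0 : Type w}
    [AddCommGroup H2K] [Module R H2K] [AddCommGroup Kinf] [Module R Kinf] [AddCommGroup X0] [Module R X0]
    (e : H2K →ₗ[R] Kinf) (he : Function.Surjective e) (i : X0 →ₗ[R] Kinf) (hi : Function.Injective i)
    [Module.Finite K (K ⊗[R] H2K)] : Module.Finite K (K ⊗[R] X0) := by
  haveI : Module.Finite K (K ⊗[R] Kinf) := finite_baseChange_of_surjective K e he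
  exact finite_baseChange_of_injective K i hi

end PortAnatomy

/-! ## §2 Level-`n` cancellation of the `S₀`-local terms -/

section Cancel

variable {R : Type u} [CommRing R]
variable {H2U P₀ P₂ : Type w} [AddCommGroup H2U] [Module R H2U] [AddCommGroup P₀] [Module R P₀]
  [AddCommGroup P₂] [Module R P₂]

/-- The image of `H²(X_n, j_*T)` in `H²(U_n, T)` modelled as `ker (fst ∘ loc)` (excision: exactness at
`H²(U_n,T)` of `H²(X_n) → H²(U_n) → ⊕_{v∈S₀} H³_v`, and `H³_v ≅ H²(ℚ_{n,v}, T)` is the `P₀`-component of `loc`). -/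
theorem snd_loc_surjective_on_ker_fst (loc : H2U →ₗ[R] P₀ × P₂) (hloc : Function.Surjective loc) :
    Function.Surjective ((LinearMap.snd R P₀ P₂ ∘ₗ loc).domRestrict
      (LinearMap.ker (LinearMap.fst R P₀ P₂ ∘ₗ loc))) := by
  intro y
  obtain ⟨x, hx⟩ := hloc (0, y)
  refine ⟨⟨x, ?_⟩, ?_⟩
  · simp [LinearMap.mem_ker, hx]
  · simp [hx]

/-- **CANCELLATION.** On `K_n := ker (fst ∘ loc)` the map to `P₂` (the `{2,∞}`-terms) is surjective and its
kernel is exactly `ker loc = X_str,S(n)` (viewed inside `K_n`): `0 → X_str → K_n → P₂ → 0`; the `S₀`-part `P₀`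
of Poitou–Tate and the `S₀`-supported `H³` of excision cancel identically. [folklore linear algebra] -/
theorem ker_snd_loc_on_ker_fst_iff (loc : H2U →ₗ[R] P₀ × P₂)
    (x : LinearMap.ker (LinearMap.fst R P₀ P₂ ∘ₗ loc)) :
    x ∈ LinearMap.ker ((LinearMap.snd R P₀ P₂ ∘ₗ loc).domRestrict
      (LinearMap.ker (LinearMap.fst R P₀ P₂ ∘ₗ loc))) ↔ (x : H2U) ∈ LinearMap.ker loc := by
  obtain ⟨x, hx⟩ := x
  simp only [LinearMap.mem_ker, LinearMap.coe_comp, Function.comp_apply, LinearMap.fst_apply] at hx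
  simp only [LinearMap.mem_ker, LinearMap.domRestrict_apply, LinearMap.coe_comp, Function.comp_apply,
    LinearMap.snd_apply, Prod.ext_iff, Prod.fst_zero, Prod.snd_zero, hx, true_and]

/-- `ker loc ≤ ker (fst ∘ loc)` (`X_str,S(n)` lies in the image of `H²(X_n, j_*T)`). -/
theorem ker_loc_le_ker_fst (loc : H2U →ₗ[R] P₀ × P₂) :
    LinearMap.ker loc ≤ LinearMap.ker (LinearMap.fst R P₀ P₂ ∘ₗ loc) := by
  intro x hx
  rw [LinearMap.mem_ker] at hx
  rw [LinearMap.mem_ker, LinearMap.comp_apply, hx, LinearMap.fst_apply, Prod.fst_zero]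

/-- The same, packaged as a short exact sequence `0 → ker loc → K_n → P₂ → 0` with the inclusion
`ker loc ↪ K_n`. -/
theorem exact_kerLoc_kerFst_snd (loc : H2U →ₗ[R] P₀ × P₂) :
    Function.Exact (Submodule.inclusion (ker_loc_le_ker_fst loc))
      ((LinearMap.snd R P₀ P₂ ∘ₗ loc).domRestrict (LinearMap.ker (LinearMap.fst R P₀ P₂ ∘ₗ loc))) := by
  intro x
  rw [← LinearMap.mem_ker, ker_snd_loc_on_ker_fst_iff]
  constructor
  · intro hx
    exact ⟨⟨(x : H2U), hx⟩, Subtype.ext rfl⟩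
  · rintro ⟨y, rfl⟩
    exact y.2

end Cancel

/-! ## §3 The archimedean line at `p = 2`: induced `C₂`-modules have trivial Tate cohomology -/

section Induced

variable {R : Type u} [CommRing R] {M : Type w} [AddCommGroup M] [Module R M]

/-- **Fixed points are norms** when `M = N ⊕ cN` for an involution `c`: `Ĥ⁰(C₂, M) = M^c / (1+c)M = 0`.
(Card: `M = W[2] ⊗ k` resp. its `ϖ`-power layers, `c` = complex conjugation, a TRANSPOSITION since `Δ_W < 0`;
`N` = the line through a non-real `2`-torsion point.) [folklore: Shapiro / cohomological triviality of induced modules] -/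
theorem fixed_eq_norm_of_isCompl (c : M →ₗ[R] M) (hc : ∀ x, c (c x) = x) (N : Submodule R M)
    (hN : IsCompl N (N.map c)) {x : M} (hx : c x = x) : ∃ n ∈ N, x = n + c n := by
  -- decompose `x = n₁ + c n₂`
  have htop : x ∈ N ⊔ N.map c := by rw [hN.sup_eq_top]; exact Submodule.mem_top
  obtain ⟨n₁, hn₁, m, hm, rfl⟩ := Submodule.mem_sup.mp htop
  obtain ⟨n₂, hn₂, rfl⟩ := Submodule.mem_map.mp hm
  -- `c x = x` forces `n₁ - n₂ ∈ N ⊓ cN = 0`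
  have h1 : n₁ - n₂ ∈ N := N.sub_mem hn₁ hn₂
  have h2 : n₁ - n₂ ∈ N.map c := by
    have hcx : c n₁ + n₂ = n₁ + c n₂ := by simpa [map_add, hc] using hx
    have : n₁ - n₂ = c (n₁ - n₂) := by
      rw [map_sub, sub_eq_sub_iff_add_eq_add]
      exact hcx.symm
    rw [this]
    exact Submodule.mem_map_of_mem h1
  have h0 : n₁ - n₂ = 0 := by
    have hmem : n₁ - n₂ ∈ N ⊓ N.map c := ⟨h1, h2⟩
    rw [hN.inf_eq_bot] at hmem
    simpa using hmem
  have h12 : n₁ = n₂ := sub_eq_zero.mp h0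
  subst h12
  exact ⟨n₁, hn₁, rfl⟩

/-- **Norm-kernel is the antinorm image** when `M = N ⊕ cN`: `Ĥ⁻¹(C₂, M) = ker(1+c) / (1-c)M = 0`. [folklore] -/
theorem ker_norm_eq_antinorm_of_isCompl (c : M →ₗ[R] M) (hc : ∀ x, c (c x) = x) (N : Submodule R M)
    (hN : IsCompl N (N.map c)) {x : M} (hx : x + c x = 0) : ∃ n ∈ N, x = n - c n := by
  have htop : x ∈ N ⊔ N.map c := by rw [hN.sup_eq_top]; exact Submodule.mem_top
  obtain ⟨n₁, hn₁, m, hm, rfl⟩ := Submodule.mem_sup.mp htop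
  obtain ⟨n₂, hn₂, rfl⟩ := Submodule.mem_map.mp hm
  -- `(n₁ + n₂) + c (n₁ + n₂) = 0` forces `n₁ + n₂ ∈ N ⊓ cN = 0`
  have hsum : (n₁ + n₂) + c (n₁ + n₂) = 0 := by
    have : n₁ + c n₂ + (c n₁ + n₂) = 0 := by simpa [map_add, hc] using hx
    rw [map_add]; rw [← this]; abel
  have h1 : n₁ + n₂ ∈ N := N.add_mem hn₁ hn₂
  have h2 : n₁ + n₂ ∈ N.map c := by
    have : n₁ + n₂ = c (-(n₁ + n₂)) := by
      rw [map_neg, eq_neg_iff_add_eq_zero, hsum]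
    rw [this]
    exact Submodule.mem_map_of_mem (N.neg_mem h1)
  have h0 : n₁ + n₂ = 0 := by
    have hmem : n₁ + n₂ ∈ N ⊓ N.map c := ⟨h1, h2⟩
    rw [hN.inf_eq_bot] at hmem
    simpa using hmem
  have h12 : n₂ = -n₁ := eq_neg_of_add_eq_zero_right h0
  subst h12
  exact ⟨n₁, hn₁, by simp [map_neg, sub_eq_add_neg]⟩

end Induced


/-! ## §4 The (KER) step's last clause: a bounded inverse system has a bounded limit -/

section SeqLimit

/-- **An inverse limit of finite sets of cardinality `≤ B` has cardinality `≤ B`.** (Card: the excision kernels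
`ker_n ⊆ ⊕_{w ∣ M} (tors (T_ρ)_{I_w}(-1))^{Frob_w = 1}` have order bounded independently of `n`, so
`ker_∞ = lim_n ker_n` is finite — the kernel of `𝐇²_Γ(T_ρ) ↠ K∞` is killed by a non-zero scalar.) [folklore] -/
theorem natCard_seqLimit_le {X : ℕ → Type w} (f : ∀ n, X (n + 1) → X n) {B : ℕ}
    (hB : ∀ n, Nat.card (X n) ≤ B) [∀ n, Finite (X n)] :
    Nat.card {x : (∀ n, X n) // ∀ n, f n (x (n + 1)) = x n} ≤ B := by
  classical
  set L := {x : (∀ n, X n) // ∀ n, f n (x (n + 1)) = x n} with hLdef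
  -- compatibility propagates equalities downwards
  have hdown : ∀ (x y : L) (m d : ℕ), x.1 (m + d) = y.1 (m + d) → x.1 m = y.1 m := by
    intro x y m d
    induction d with
    | zero => exact id
    | succ d ih =>
        intro h
        apply ih
        have h' : x.1 (m + d + 1) = y.1 (m + d + 1) := h
        rw [← x.2 (m + d), ← y.2 (m + d), h']
  rcases finite_or_infinite L with hL | hL
  · -- a level separating every pair of distinct points of the (finite) limit
    haveI := Fintype.ofFinite L
    have hsep : ∀ x y : L, x ≠ y → ∃ m, x.1 m ≠ y.1 m := by
      intro x y hne
      by_contra h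
      exact hne (Subtype.ext (funext fun m ↦ not_not.mp (not_exists.mp h m)))
    let lev : L × L → ℕ := fun q ↦ if h : q.1 ≠ q.2 then (hsep q.1 q.2 h).choose else 0
    let N : ℕ := Finset.univ.sup lev
    have hinj : Function.Injective (fun x : L ↦ x.1 N) := by
      intro x y hxy
      by_contra hne
      have hm : x.1 (lev (x, y)) ≠ y.1 (lev (x, y)) := by
        have : lev (x, y) = (hsep x y hne).choose := dif_pos hne
        rw [this]
        exact (hsep x y hne).choose_spec
      have hle : lev (x, y) ≤ N := Finset.le_sup (f := lev) (Finset.mem_univ (x, y))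
      obtain ⟨d, hd⟩ := Nat.exists_eq_add_of_le hle
      apply hm
      apply hdown x y (lev (x, y)) d
      rw [← hd]
      exact hxy
    calc Nat.card L ≤ Nat.card (X N) := Nat.card_le_card_of_injective _ hinj
      _ ≤ B := hB N
  · rw [Nat.card_eq_zero_of_infinite]
    exact Nat.zero_le B

end SeqLimit

end Summit.BirchSwinnertonDyer.BirchSwinnertonDyer.Cruxes.ResidualThetaCountLowerPureAtTwo.SideaK2G23

end
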